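import Summits.MatrixMultiplication.MatrixMultiplication.Theses.DefinableSTPPDichotomy
import Summits.MatrixMultiplication.MatrixMultiplication.Theorems.PairwiseCurvedTilingsLC.Negative.UniformEta

/-!
# Disproof of `PairwiseCurvedTilingsLC` (stmt-MatrixMultiplication-17883) — findings

cdisprove seat, cycle 1 (2026-08-17).  Read with: `Cruxes/PairwiseCurvedTilingsLC/`
`NEGATIVE-lonely-translates.md`, `NEGATIVE-chebotarev-curve-recurrence.md`, `LonelyTranslates.lean`,
`ChebotarevRecurrenceSketch.lean` (crux-ideate r1 k1/k2), item evidence `ATTACK-LC.md` (crux-attack),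
and the landed `Theorems/PairwiseCurvedTilingsLC/Negative/UniformEta.lean` (p144891).

## §0 VERDICT: CONDITIONALLY REFUTED (negative lemma modulo `H` landed)

* LANDED this cycle (all ACCEPTED):
  - p147949 `Theorems/PairwiseCurvedTilingsLC/Negative/PairwiseCurvedTilingsLCShadowCounting.lean`
    (def-free helpers): `isolating_translates` (pattern `k = i`), `card_bcShadow` (the `B − C`
    packing), `mass_le_of_bcShadowBound` (shadow bound on the big blocks ⇒ mass ≤ (C+(2+C)/3)q^m),
    `bcShadow_le_of_recurrence` (recurrence off `E` ⇒ big blocks' shadow ⊆ `E`).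
  - p148338 `…/Negative/PairwiseCurvedTilingsLCFalseOfDefinableTranslateRecurrenceLC.lean`
    (`--negative-modulo DefinableTranslateRecurrenceLC`; THE NEGATIVE LEMMA):
    `PairwiseCurvedTilingsLC_false_of_DefinableTranslateRecurrenceLC :
       Literature.ModelTheory.PseudofiniteFields.DefinableTranslateRecurrenceLC → ¬ PairwiseCurvedTilingsLC`,
    with the first-order plumbing (`shadowFormula`, `blockFormula`).  `H` was relocated by the gate to
    `Literature/ModelTheory/PseudofiniteFields/DefinableTranslateRecurrenceLC.lean` (p148337, named
    fact, debt +1) — the construction item provers/grounders must now discharge (vendor/prove).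
  - p148335 `…/Negative/PairwiseCurvedTilingsLCThinBlocks.lean`: the thin-block strengthening is
    FALSE unconditionally (§3; the same two theorems as below).
  - earlier (crux-attack g2): `UniformEta.lean` p144891 (counting, η ≤ mε/3, uniform-η form FALSE) and
    `CommonTranslate.lean` (a common translate `T` inside one colour class costs `|T|` in the
    complementary packing ⇒ no single class of a witness consists of translates of one set).
* `H = DefinableTranslateRecurrenceLC` (two ARBITRARY ring formulas `τ(w;ȳ)`, `α(v;ȳ')`; in every
  finite field of large CHARACTERISTIC, every point `t ∈ T = τ(F^m;ȳ)` off an exceptional set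
  `|E| ≤ C|F|^{m−1}` depending on `τ,ȳ` only is translated into `T` by `≥ c|A|²` pairs
  `(a₀,a) ∈ A²`, `A = α(F^m;ȳ')`, once `|A| > K`) is classical arithmetic geometry — Galois
  stratification [Kiefe 1976], uniform Chebotarev for finite étale Galois covers [Katz–Sarnak 1999,
  Thm 9.7.13], Lang–Weil, CDM 1992 — none of it in Mathlib: the item is HELD on `H`, not refuted.
  It is the crux's regime form (weaker) of ideator k=2's all-characteristic named fact.
* WHAT WOULD CHANGE THE VERDICT: only `¬H`.  A counterexample to `H` would be a uniformly definable
  dense `T ⊆ F^m` with a definable positive-dimensional `A` (parameters may depend on `t`) such that a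
  positive proportion of the points `t ∈ T` are "lonely": `t + (A − A)^* ∩ T` of size `o(|A|)` on
  average.  Along the translated top component of `Zar(A)` through a point `t` off the ramification
  locus this contradicts Chebotarev; §4 audits the degenerate cases and job j023984 checks it
  numerically (m = 1, 2; character-pattern `T`, lines/conics/t-dependent curves `A`).

## §1 LOAD-BEARING ANALYSIS (the crux is an ∃-statement: dropping a condition on the witness makes it
WEAKER, so "false without H" is replaced by "trivially TRUE without H" = H is load-bearing, and by
refuted STRENGTHENINGS)

| condition on the witness      | drop it ⇒                                   | consumed by the kill?            |
|-------------------------------|---------------------------------------------|----------------------------------|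
| block TPP (pattern i=j=k)     | TRUE trivially (A_x=S+(0,x), B_x=S+(0,2x), C_x=S, S=F^d×0: mass q^{m+d+dε}) | yes (abc ≤ q^m; injectivity in `card_bcShadow`) |
| the three 2-label patterns    | TRUE trivially (I = F^e copies of one direct-sum frame)              | ONE pattern in full (`k=i`, isolating translates); the other two only as packings |
| mass ≥ |F|^{m+η}              | TRUE trivially (point family {x},{2x},{4x}: pairwise-STPP, mass = q^m exactly) | yes, at the single ε = 1/(m+1) |
| ∀ ε (vs one ε)                | excludes the ε ≥ 1 parasites (ATTACK-LC §2) | NOT consumed (one ε suffices)    |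
| definability of I, A, B, C    | OPEN combinatorial question (no non-definable tight pairwise-STPP family with unbounded blocks is known in bounded rank either; census target) | yes (H is about definable sets) |
| q₀ ≤ ringChar F (char → ∞)    | = dropped stmt-18074; same kill (ideators' all-char R) | only as |F| → ∞ + regime of H |

## §2 COUNTING / TIGHTNESS (landed, UniformEta.lean p144891; ATTACK-LC.md §2)
`card_mul_card_mul_card_le` (abc ≤ q^m), `sum_card_AB/BC/AC_le` (three packings),
`sum_rpow_le_card_rpow` (mass ≤ q^{m(1+ε/3)}), `eta_le` (η ≤ mε/3),
`not_PairwiseCurvedTilingsLC_uniformEta` (∃η ∀ε form FALSE).  CDM numerology (paper): only cells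
(m; d,d,d), 1 ≤ d ≤ m/3, N ≍ q^{m−2d} labels survive; m ≤ 2 dead; constants free (density regime).

## §3 NEW UNCONDITIONAL NO-GO (proved below, sorry-free): THIN BLOCKS ARE DEAD
`not_PairwiseCurvedTilingsLC_thinBlocks K`: the crux strengthened by "every block has a colour class
of size ≤ K" (`|A_x| ≤ K ∨ |B_x| ≤ K ∨ |C_x| ≤ K` for all `x ∈ I`) is FALSE for every `K`: at ε = 1
the mass is `Σ abc ≤ K·Σ(ab+bc+ca) ≤ 3K q^m < q^{m+η}`.  Hence in any witness, for every K, fields far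
enough along the sequence carry blocks with ALL THREE sets of size > K — by CDM, blocks all of whose
classes are positive-dimensional — and `mass_thin_le` says the thin blocks never carry more than
`3K q^m` of the mass.  This is the formal PINCER: thin blocks die by counting (here), fat blocks die
by `H` (negative lemma).  (The k1 note §2 makes the same split with C₀ = CDM's bound.)

## §4 AUDIT OF `H` (adversarial; H is the hinge of the kill)
(a) m = 0: |A| ≤ 1, count = |A|² — needs only c ≤ 1.  (b) T of dimension < m: take E := T.
(c) dim A = 0: excluded by K (CDM: finite definable sets are uniformly bounded).  (d) additive
subgroups of bounded index (Artin–Schreier images {u²+u}) exist only in bounded characteristic —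
outside the LC form; subfields F_p ⊂ F_{p²} are not uniformly definable (CDM sizes μq^d, d ∈ ℕ).
(e) A depending on t (allowed: ∀ȳ' after ∃E): e.g. T = □×F ⊂ F², A = two vertical lines
{a₁ ∈ {0,d(t)}} with u₀ ± d ∉ □: still count ≥ |A|²/2 (same-line pairs); making many classes needs a
definable D(t) with D − D ⊆ (nonsquares − u₀) ∪ {0}, impossible beyond |D| = O(1) (Weil), and a
bounded D only costs a constant (c ~ 1/|D|).  (f) generic mechanism: t ∉ Z (ramification/lower
strata of τ's Galois stratification, |Z(F)| = O(q^{m−1})) ⇒ along Γ = t − a₀ + 𝒱 (𝒱 a top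
component of Zar(A), a₀ generic on it) the joint Frobenius class of t recurs at ≥ q^{dim 𝒱}/|G| −
O(q^{dim 𝒱 − 1/2}) points (Katz–Sarnak 9.7.13 = uniform Chebotarev), each giving a pair.  No gap found.
(g) NUMERICS: kit job j023984 (`compute/recurrence_census.py`): min over t ∈ T of
ρ(t) = #{(a₀,a): t+a−a₀ ∈ T}/|A|² for character-pattern / polynomial-image T and lines, conics,
hyperbola, circle, t-dependent parabolas/cubics A; m = 1 (p ≤ 401), m = 2 (p ≤ 71).  Results are
appended to NOTES.md / evidence when the job returns (expected: ρ bounded below ≈ 2^{−#conditions}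
away from O(p^{m−1}) ramification points).

## §5 ESCAPE HATCHES FOR THE CRUX (what a prover would have to do)
Given the negative lemma, a witness of the crux must REFUTE `H`: its fat blocks' shadow
`T = ⋃(B_x − C_x)` (dimension m, density bounded below) must have lonely generic points along the
definable curves `t − a₀ + A_x`.  By §4(f) this needs the translated curve to lie INSIDE the
ramification/lower-stratum locus Z of T for a positive proportion of t — impossible since t ∈ Γ∖Z.
The only consistent readings: (i) all blocks thin (dead by §3), (ii) non-definable families (outside
the crux), (iii) bounded characteristic (outside the crux; Thm B regime).  I see no repair of the
dodge inside the definable world; the honest outcome of the route is its negative side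
(`DefinableDesignBarrier` with ε = 1/(2m) from the same H, ideator k2 `ConditionalBarrier`).

## §6 TARGETS (lead's stuck stubs): none registered this cycle (no skeleton/line yet; SKELVET FAIL).

## §7 DEAD CONSTRUCTION LEVERS (collected; each dies at the porosity step = isolating translates)
translate families (TranslateFamiliesFail, one pattern suffices); full frames/cones (≤ 2 blocks,
BoundedRankFrameBarrier); exact (p,p,p) tiles over F_p (Rédei ⇒ a line class ⇒ spill = everything);
linear label invariants (B_x must spread along the label functional ⇒ R_x − R_x ⊇ F∖O(1) ⇒ O(1)
labels); quadric level sets {Q(a−c) = x} (force A or C into lines: P(v) = (v,Q(v),1) spans ≤ 3 dims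
only on lines); norm tori / dilation families θ·D (need D on a level set of a homogeneous form, then
sum–product makes the spill dense); quadratic-residue "Paley" pore certificates and half-parabola
fibre families (ideator k3 toys: violation rates 0.67–1.0); osculating flats (k3; dies in (6;1) by its
own census, R applies in general); subfield / Artin–Schreier tiles (not uniformly definable).
-/

set_option linter.dupNamespace false  -- `Summit.<S>.<S>.…` is the mandated namespace

namespace Summit.MatrixMultiplication.MatrixMultiplication.Cruxes.PairwiseCurvedTilingsLC.Disproof

open Finset
open Summit.MatrixMultiplication.MatrixMultiplication.Theses.DefinableSTPPDichotomy
open Summit.MatrixMultiplication.MatrixMultiplication.Theorems.PairwiseCurvedTilingsLC.Negative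

/-! ## §3 (Lean) Thin blocks carry at most `3K·|H|` of the mass; the thin-block strengthening is false -/

section Thin

variable {H : Type*} [AddCommGroup H] [Fintype H] {ι : Type*} {I : Finset ι} {A B C : ι → Finset H}
  (hP : ∀ i ∈ I, ∀ j ∈ I, ∀ k ∈ I, (i = j ∨ j = k ∨ k = i) →
    ∀ s ∈ A k, ∀ s' ∈ A i, ∀ t ∈ B i, ∀ t' ∈ B j, ∀ u ∈ C j, ∀ u' ∈ C k,
      (s' - s) + (t' - t) + (u' - u) = 0 → i = j ∧ j = k ∧ s = s' ∧ t = t' ∧ u = u')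
include hP

/-- **Thin blocks carry little mass.**  If every block of a pairwise-STPP family has a colour class
of size `≤ K`, then `Σ_x |A_x||B_x||C_x| ≤ 3K·|H|` (per block `abc ≤ K(ab + bc + ca)`, then the
three packings of `UniformEta.lean`). -/
theorem sum_card_mul_le_of_thin (K : ℕ)
    (hthin : ∀ x ∈ I, (A x).card ≤ K ∨ (B x).card ≤ K ∨ (C x).card ≤ K) :
    ∑ x ∈ I, (A x).card * (B x).card * (C x).card ≤ 3 * K * Fintype.card H := by
  set I' := I.filter (fun x => (A x).Nonempty ∧ (B x).Nonempty ∧ (C x).Nonempty) with hI'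
  have hAB := sum_card_AB_le hP (H := H)
  have hBC := sum_card_BC_le hP (H := H)
  have hAC := sum_card_AC_le hP (H := H)
  rw [← hI'] at hAB hBC hAC
  -- only the blocks of `I'` contribute
  have hsplit : ∑ x ∈ I, (A x).card * (B x).card * (C x).card =
      ∑ x ∈ I', (A x).card * (B x).card * (C x).card := by
    rw [hI', sum_filter_of_ne]
    intro x _ hx
    by_contra hcon
    apply hx
    simp only [not_and_or, not_nonempty_iff_eq_empty] at hcon
    rcases hcon with h' | h' | h' <;> simp [h']
  rw [hsplit]
  have hper : ∀ x ∈ I', (A x).card * (B x).card * (C x).card ≤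
      K * ((A x).card * (B x).card + (B x).card * (C x).card + (A x).card * (C x).card) := by
    intro x hx
    have hxI : x ∈ I := (mem_filter.1 (hI' ▸ hx)).1
    rcases hthin x hxI with h | h | h
    · calc (A x).card * (B x).card * (C x).card = (A x).card * ((B x).card * (C x).card) := by ring
        _ ≤ K * ((B x).card * (C x).card) := Nat.mul_le_mul_right _ h
        _ ≤ _ := by nlinarith [Nat.zero_le ((A x).card * (B x).card), Nat.zero_le ((A x).card * (C x).card)]
    · calc (A x).card * (B x).card * (C x).card = (B x).card * ((A x).card * (C x).card) := by ring
        _ ≤ K * ((A x).card * (C x).card) := Nat.mul_le_mul_right _ h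
        _ ≤ _ := by nlinarith [Nat.zero_le ((A x).card * (B x).card), Nat.zero_le ((B x).card * (C x).card)]
    · calc (A x).card * (B x).card * (C x).card = (C x).card * ((A x).card * (B x).card) := by ring
        _ ≤ K * ((A x).card * (B x).card) := Nat.mul_le_mul_right _ h
        _ ≤ _ := by nlinarith [Nat.zero_le ((B x).card * (C x).card), Nat.zero_le ((A x).card * (C x).card)]
  calc ∑ x ∈ I', (A x).card * (B x).card * (C x).card
      ≤ ∑ x ∈ I', K * ((A x).card * (B x).card + (B x).card * (C x).card + (A x).card * (C x).card) :=
        sum_le_sum hper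
    _ = K * (∑ x ∈ I', (A x).card * (B x).card + ∑ x ∈ I', (B x).card * (C x).card +
          ∑ x ∈ I', (A x).card * (C x).card) := by
        rw [← mul_sum, sum_add_distrib, sum_add_distrib]
    _ ≤ K * (Fintype.card H + Fintype.card H + Fintype.card H) := by gcongr
    _ = 3 * K * Fintype.card H := by ring

end Thin

/-- The characteristic of a finite field is at most its cardinality. -/
theorem ringChar_le_card (F : Type*) [Field F] [Fintype F] : ringChar F ≤ Fintype.card F := by
  obtain ⟨n, hp, hcard⟩ := FiniteField.card F (ringChar F)
  rw [hcard]
  exact Nat.le_self_pow n.ne_zero _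

/-- **The thin-block strengthening of the crux is FALSE** (unconditional, every `K`): there is no
witness of `PairwiseCurvedTilingsLC` all of whose blocks have a colour class of size `≤ K`.  At
`ε = 1` the mass is `Σ abc ≤ 3K·|F|^m` (`sum_card_mul_le_of_thin`), `< |F|^{m+η}` once `|F|^η > 3K`.
So every witness has, far along its field sequence, FAT blocks (`|A_x|, |B_x|, |C_x| > K`) carrying
all but `3K|F|^m` of the mass — for definable families, blocks with three positive-dimensional
classes (CDM), which is where `DefinableTranslateRecurrenceLC` bites. -/
theorem not_PairwiseCurvedTilingsLC_thinBlocks (K : ℕ) :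
    ¬ ∃ (e m k : ℕ) (φI : FirstOrder.Language.ring.Formula (Fin e ⊕ Fin k))
        (φA φB φC : FirstOrder.Language.ring.Formula ((Fin e ⊕ Fin m) ⊕ Fin k)),
        ∀ ε : ℝ, 0 < ε → ∃ η : ℝ, 0 < η ∧ ∀ q₀ : ℕ, ∃ (F : Type) (_ : Field F) (_ : Fintype F)
          (_ : FirstOrder.Ring.CompatibleRing F), q₀ ≤ ringChar F ∧ ∃ (y : Fin k → F)
          (I : Finset (Fin e → F)) (A B C : (Fin e → F) → Finset (Fin m → F)),
          (∀ x, x ∈ I ↔ φI.Realize (Sum.elim x y)) ∧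
          (∀ x v, v ∈ A x ↔ φA.Realize (Sum.elim (Sum.elim x v) y)) ∧
          (∀ x v, v ∈ B x ↔ φB.Realize (Sum.elim (Sum.elim x v) y)) ∧
          (∀ x v, v ∈ C x ↔ φC.Realize (Sum.elim (Sum.elim x v) y)) ∧
          (∀ i ∈ I, ∀ j ∈ I, ∀ k ∈ I, (i = j ∨ j = k ∨ k = i) → ∀ s ∈ A k, ∀ s' ∈ A i,
            ∀ t ∈ B i, ∀ t' ∈ B j, ∀ u ∈ C j, ∀ u' ∈ C k,
            (s' - s) + (t' - t) + (u' - u) = 0 → i = j ∧ j = k ∧ s = s' ∧ t = t' ∧ u = u') ∧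
          (Fintype.card F : ℝ) ^ ((m : ℝ) + η) ≤
            ∑ x ∈ I, (((A x).card * (B x).card * (C x).card : ℕ) : ℝ) ^ ((2 + ε) / 3) ∧
          (∀ x ∈ I, (A x).card ≤ K ∨ (B x).card ≤ K ∨ (C x).card ≤ K) := by
  rintro ⟨e, m, k, φI, φA, φB, φC, h⟩
  obtain ⟨η, hη, hall⟩ := h 1 one_pos
  set N : ℕ := Nat.ceil (((3 * K : ℕ) + 1 : ℝ) ^ (1 / η)) with hN
  obtain ⟨F, instF, instFin, instCR, hchar, y, I, A, B, C, -, -, -, -, hP, hmass, hthin⟩ :=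
    hall (max N 2)
  have hcardF : max N 2 ≤ Fintype.card F := hchar.trans (ringChar_le_card F)
  set q : ℝ := (Fintype.card F : ℝ) with hqdef
  have hq2 : (2 : ℝ) ≤ q := by
    rw [hqdef]; exact_mod_cast le_trans (le_max_right _ _) hcardF
  have hq0 : (0 : ℝ) < q := by linarith
  have hKq : ((3 * K : ℕ) : ℝ) < q ^ η := by
    have h1 : (((3 * K : ℕ) : ℝ) + 1) ^ (1 / η) ≤ q := by
      have : (N : ℝ) ≤ q := by
        rw [hqdef]; exact_mod_cast le_trans (le_max_left _ _) hcardF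
      exact le_trans (Nat.le_ceil _) this
    have h2 : ((3 * K : ℕ) : ℝ) + 1 ≤ q ^ η := by
      calc ((3 * K : ℕ) : ℝ) + 1 = ((((3 * K : ℕ) : ℝ) + 1) ^ (1 / η)) ^ η := by
            rw [← Real.rpow_mul (by positivity), one_div, inv_mul_cancel₀ hη.ne', Real.rpow_one]
        _ ≤ q ^ η := Real.rpow_le_rpow (by positivity) h1 hη.le
    linarith
  -- at `ε = 1` the mass is `Σ abc`
  have hexp : ((2 : ℝ) + 1) / 3 = 1 := by norm_num
  rw [hexp] at hmass
  simp only [Real.rpow_one] at hmass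
  have hthinle := sum_card_mul_le_of_thin (H := Fin m → F) hP K hthin
  have hcardH : (Fintype.card (Fin m → F) : ℝ) = q ^ (m : ℝ) := by
    rw [Real.rpow_natCast, Fintype.card_fun, Fintype.card_fin]; push_cast; rfl
  have hmass' : q ^ ((m : ℝ) + η) ≤ ((3 * K : ℕ) : ℝ) * q ^ (m : ℝ) := by
    calc q ^ ((m : ℝ) + η) ≤ ∑ x ∈ I, (((A x).card * (B x).card * (C x).card : ℕ) : ℝ) := hmass
      _ = ((∑ x ∈ I, (A x).card * (B x).card * (C x).card : ℕ) : ℝ) := by push_cast; rfl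
      _ ≤ ((3 * K * Fintype.card (Fin m → F) : ℕ) : ℝ) := by exact_mod_cast hthinle
      _ = ((3 * K : ℕ) : ℝ) * q ^ (m : ℝ) := by rw [← hcardH]; push_cast; ring
  have hlt : ((3 * K : ℕ) : ℝ) * q ^ (m : ℝ) < q ^ ((m : ℝ) + η) := by
    rw [Real.rpow_add hq0, mul_comm]
    exact mul_lt_mul_of_pos_left hKq (Real.rpow_pos_of_pos hq0 _)
  exact absurd hmass' (not_le.2 hlt)

end Summit.MatrixMultiplication.MatrixMultiplication.Cruxes.PairwiseCurvedTilingsLC.Disproof
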